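/-
Copyright: statement-level skeleton of a published paper (lit-balaban cell, Phase-2 proof seat p26 gen 46). No claims beyond
what the kernel checks below.
-/
import Mathlib
import Literature.MathematicalPhysics.QuantumFieldTheory.Balaban1983to89.B3GraphAmplitudePositionForm
import Literature.MathematicalPhysics.QuantumFieldTheory.Balaban1983to89.B3Eq213TorusBoxSeam
import Literature.MathematicalPhysics.QuantumFieldTheory.Balaban1983to89.B3Ineq213Proof

/-!
# B3 — T. Bałaban, *(Higgs)₂,₃ quantum fields in a finite volume. III. Renormalization*, CMP **88** (1983) 411–445
[Balaban1983Higgs3] — p. 426 [PDF 16] (2.13) with p. 420 [PDF 10] (the localizations `{□(v)}_{v∈G}`, the tree length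
`d({□(v)}_{v∈G})`) and the torus distance (1.3) p. 604 of part I [Balaban1982Higgs1]: **THE FIRST ESTIMATE (2.13) FOR THE
EXPRESSION OF A BLOCK-LOCALIZED GRAPH ANYWHERE ON THE TORUS `T_η`** (FILE 18 of the Feynman-rule evaluator lineage
`B3GraphAmplitude` (FILE 1) … `B3Eq213TorusBoxSeam` (FILE 17); item 5 ∕ § g45 PLUG-IN RECIPE of
`HOME/lit-balaban-p26/DESIGN-B3-evaluator.md`).

statement-level skeleton of published theorems with citation tags; proofs where landed; nothing here is a claim about
the Yang–Mills mass gap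

PDF held: `paper:balaban1983-higgs-2-3-quantum-fields-finite-volume` (journal page = PDF page + 410); p. 420 [PDF 10] and
p. 426 [PDF 16] read by this seat on the text layer `~/.lit/texts/paper-balaban1983-higgs-2-3-quantum-fields-finite-volume/p0010.txt`,
`p0016.txt` (2026-08-25).

CITATION HEADER (lean-in-tree rule).  lit-balaban TYPED SKELETON (HOME `run/shared/lean/pub/lit-balaban/`), PHASE 2, seat p26 gen 46
(unit `lit-balaban-p26`; free-target protocol G.5-34(d), own lane, TAKING announced HOME/STATUS.md 2026-08-25T04:23Z).  ROWS
**B3.Eq2.13-2.14** ((2.13) p. 426; head `proved` by p19's `B3Ineq213Proof`), **B3.Prop1** (p. 420), **B3.Def@420** of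
`HOME/lit-balaban-r15/ROWS-B3.md` (fold owner r15; this file is an OPTIONAL located member, cells only, zero head weight).
CONSUMES BY NAME, nothing re-declared: FILE 12 `B3GraphAmplitudePositionForm` (p378154): `attSK`, `attVK`, `attO`, `uOfKind`,
`Lines`, `lineSrc`, `lineTgt`, `extAt`, `ampOf`, `E_ampOf`, `modelOfGraph`, **`abs_graphAmp_le_ampE`**; FILE 17
`B3Eq213TorusBoxSeam` (p381901 ∕ p382732 ∕ p384590): `labelsOf`, `labelsOf_lt`, `labelChartAt`, `blockCorner`,
`labelChartAt_injOn_pts`, `tdist_labelChartAt_le_supDist`, `tdist_labelChartAt_eq_supDist_of_blocks`,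
`mem_blockK_iff_exists_labelChartAt`, `relLabels_lt_half_of_tdist_le`; p19's `B3Ineq213.{Amp, Amp.E, pts, boxPositions,
mem_boxPositions, boxPositions_nonempty, supDist, LinesConnect, treeLen, edgeLen, boxTreeLen}` and **`Amp.abs_E_le`** ((2.13),
PROVED in `B3Ineq213Proof`); gen-2's `B3Ineq215.{Model, Model.sc, Model.Mon, Model.W, Model.W_nonneg, Cube}`; FILE 1's
`SLine/VLine/ExtSLeg/ExtVLeg/OutPairing/sPairing/vPairing/oRank`; FILE 2's `Model`, `Loc`, `graphAmp`; p18's `B3Cor23Concrete.Graph`;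
the typer's `HiggsLattice.{Params, Site, Site.tdist, PBond}`; `HiggsAveraging.{blockK, mem_blockK}`.

THE PRINTED TEXT (verbatim).  p. 420 [PDF 10]: *"The expressions (1.12)-(1.15) are localized by fixing a point y ∈ T₁^{(k)} ∩ Ω,
or the unit cube B^k(y). Thus with each expression there is connected some localization {□(v)}_{v∈G} (v is a vertex of a graph G
corresponding to this expression). … d({□(v)}_{v∈G}) denotes a length of a shortest tree graph connecting the vertices v localized
in □(v), v ∈ G"*.  p. 426 [PDF 16]: *"For the propagators G^η_{(j)} we apply the inequality |G^η_{(j)}(Ω, B̃; x, x′)| ≦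
O(1)(L^jη)^{−d+2}e^{−δ₁(L^jη)^{−1}|x−x′|}, (2.10) … After all these operations we get the following inequality:
|Σ_{j∈J(l̃)} E(G(j), {□(v)}_{v∈G}, Φ′_ext, A_ext)| ≦ O(1)(e(L^kε))^{d_v(G)}(λ(L^kε))^{d_s(G)} exp[−(δ₁/2)d({□(v)}_{v∈G})]
‖hΦ_ext‖₁‖h′A_ext‖₁ Σ_{j∈J(l̃)} Ẽ(G(j), {□(v)}_{v∈G}), (2.13)"*.  [Balaban1982Higgs1] p. 604, (1.3): *"|x − y| =
max_μ min{|x_μ − y_μ|, 2L_μ − |x_μ − y_μ|}"* (the typer's `HiggsLattice.Site.tdist`, lattice units).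

WHY THIS FILE ∕ READING (declared).  p19 PROVED (2.13) (`B3Ineq213Proof.Amp.abs_E_le`) for the class `B3Ineq213Amplitude.Amp` of
localized lattice graph amplitudes whose positions are LABELS `ξ ∈ ℕ^d` of boxes `□(v) = ⟨k, box v⟩` with the sup label distance
`supDist` (its header: *"Reading choices … positions on ηℤ^d_{≥0} in η-units, sup-norm distances"*).  FILE 12 §7 ∕ §8
(`abs_graphAmp_le_ampE`, `abs_graphAmp_le_ampE_blocks`) put the expression `E(G, {□(v)}, Φ_ext, A_ext)` of every graph of p18's model
(FILE 2's `graphAmp`) into that class through CHARTS of the unit cubes, with the analytic inputs as hypotheses in p19's LABEL form —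
in particular the line bounds `K_le` ask the kernels of `T_η`, read at charted labels, to decay in `supDist`, which for the coordinate
chart of FILE 12 §8 is the torus distance only away from the seam of the chart (FILE 12's and FILE 16's HONEST SCOPE).  FILE 17
supplied the lattice arithmetic of the seam: the BASED chart `labelChartAt P 0 b` about any base point, `tdist ≤ supDist` always and
`=` for blocks in the half-box of labels about the base point, the based block chart `mem_blockK_iff_exists_labelChartAt`, and the
choice of the base block `p − D` for a configuration of blocks within torus distance `D` of `p`, `2D < L^{K−k}ML′_μ`.  THIS FILE
ASSEMBLES THEM (the § g45 plug-in recipe): for a graph whose vertex functions live in blocks `B^k(y_v)` ANYWHERE on `T_η` (the printed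
localizations of p. 420: unit cubes `B^k(y)` of the `η`-lattice) such that all `y_v` lie within torus distance `D` of one block `p`
with `2D < L^{K−k}ML′_μ` (the block set has torus diameter below half a half-period — it never sees the seam of the chart about
`p − D`), the chart hypotheses `hinj` ∕ `hsupp` of FILE 12 §7 are DISCHARGED and p19's `K_le` is DERIVED from line bounds stated ON THE
TORUS in the printed distance (1.3): `|K_l(t; x, x′)| ≤ C_l (L^tη)^{a_l} exp[−2δ₀ (L^tη)^{−1} · η·tdist(x, x′)]` for ALL sites
`x, x′ ∈ T_η` — the shape in which the tree PROVES (2.10) (FILE 16 `B3Ineq210ZeroHiggsTorus.gpieceH_bounds_model` at zero background;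
r14's `B3Ineq210RegularTorus` at a regular background), with NO condition on the kernels at the seam.  Then p19's PROVED (2.13)
applies: **`abs_graphAmp_le_ineq213_torusBlocks`**.  Finally the tree length: p19's `boxTreeLen` is the minimum over label positions
of the tree length in `η·supDist`; print's `d({□(v)})` on the torus is the minimum over the sites of the blocks of the tree length in
`η·tdist` (`torusTreeLen`); since `tdist ≤ supDist` ALWAYS (FILE 17 `tdist_labelChartAt_le_supDist`), `torusTreeLen ≤ boxTreeLen` of
the relative label boxes for EVERY base block (`torusTreeLen_le_boxTreeLen_relBox`), so the bound holds with print's torus tree length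
(**`abs_graphAmp_le_ineq213_torus`**).  This is FILE 12 §7's `abs_graphAmp_le_ampE` in p19's currency (vertex functions `uOfKind`;
FILE 14's header: the tool for graphs WITHOUT differentiated φ′-legs); the SIGNED twin for ALL graphs ((2.11) currency, FILE 14's
`abs_graphAmp_le_ampE_signed`) is the companion FILE 19 `B3Ineq213TorusBlocksSigned`.

WHAT IS TYPED ∕ PROVED (definitions with bodies + theorems; no `Prop` fact, no `sorry`; standard axioms).
§1 `baseBlock p D` (`= p − D`), `baseBlock_apply`, `relBox c₀ y` (`= labelsOf (y − c₀)`, the RELATIVE block position), `relBox_apply`,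
`relBox_lt_sitesPerDir`, **`relBox_baseBlock_lt_half`** (FILE 17's `relLabels_lt_half_of_tdist_le`), `injOn_pts_relBox` (FILE 12 §7's
`hinj` for the based chart), `exists_pts_relBox_of_mem_blockK` ∕ `mem_blockK_of_mem_pts_relBox` (FILE 17's based block chart),
**`supp_of_blockSupport`** (FILE 12 §7's `hsupp` from block support), `tdist_basedChart_eq_supDist`, **`lineBounds_basedChart_of_torus`**
(p19's `K_le` body for kernels read through the based chart, from TORUS-shape bounds on all of `T_η`).
§2 **`abs_graphAmp_le_ampE_torusBlocks`** (`|E(G, {B^k(y_v)}, Φ_ext, A_ext)| ≤ E_j` of the packaged amplitude with boxes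
`relBox (p − D) y_v` and charts `labelChartAt P 0 (blockCorner (p − D))`; hypotheses: FILE 12's `hKs/hKv/hKo/hΦ/hA/hΨ` verbatim, block
support `hloc`, the configuration hypothesis `hy`/`hD`, the vertex bounds `u_le` at all sites, the line bounds `hKT` in torus shape at
all sites), **`abs_graphAmp_le_ineq213_torusBlocks`** (composition with p19's `Amp.abs_E_le`: for `j ∈ J(l̃)`,
`|E| ≤ (Π_l C_l)·e^{d_v(G)}λ^{d_s(G)}·exp[−δ₀·boxTreeLen(relative boxes)]·(Π N^Φ_v)(Π N^A_v)·W`, `W` = gen-2's weight sum (2.14)).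
§3 `treeLen_mono`, `torusEdgeLen` (`η·tdist`), `blockPositions` (`x_v ∈ B^k(y_v)`), `mem_blockPositions`, `blockPositions_nonempty`,
**`torusTreeLen`** (print's `d({□(v)})` for the block set, torus distance), `torusTreeLen_le_treeLen`, `torusTreeLen_nonneg`,
**`torusTreeLen_le_boxTreeLen_relBox`**, **`abs_graphAmp_le_ineq213_torus`** ((2.13) with `exp[−δ₀·d_T({B^k(y_v)})]`).
HONEST SCOPE.  (a) Bookkeeping only: the analytic inputs stay hypotheses exactly as in FILE 12 §7 ∕ p19's `Amp` — the line bounds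
(now in TORUS shape, (2.10)–(2.12) with the dimensions `a_l`; where they come from: FILE 16 at zero background, r14/p40 at a regular
background, (2.12) files for averaged legs, (1.18) for output pairs — by name, not imported), the contracted-attachment hypotheses
`hKs/hKv/hKo` and external data `hΦ/hA/hΨ` of FILE 12, the vertex bounds `u_le` (couplings, `η`-powers `e_v ≥ 0`, norms), connectivity.
(b) THE ONLY GEOMETRIC RESTRICTION is the configuration hypothesis `hy`/`hD`: all blocks `y_v` lie within torus distance `D` of ONE
block `p ∈ T^{(k)}` with `2D < L^{K−k}ML′_μ` in every direction (the block set has torus diameter below half a half-period); the blocks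
may sit ANYWHERE on `T_η` (across the seam of any fixed chart included) and NO condition is put on the kernels beyond the torus-shape
bounds at all sites.  The vertex functions are supported in blocks `B^k(y_v)` (p. 420's unit-cube ∕ point localizations; FILE 12 §8
`uOfKind_cube_eq_zero` ∕ `uOfKind_point_eq_zero`; the smooth side-2 leg localizations go through FILE 12 §9's block refinement first).
A block set spread over more than half a half-period of `T_η` is outside p19's box reading of (2.13) and stays outside (FILE 17's
HONEST SCOPE; the torus version of the summation over positions would be p19's ∕ r15's call).  (c) `δ₀` here is p19's `Model.δ₀`
(print's `δ₁∕2`): the torus hypothesis is written with `2δ₀`, i.e. print's `δ₁`.  (d) PRINT'S `d({□(v)}_{v∈G})` ON `T_η` IS THE TORUS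
TREE LENGTH `torusTreeLen k y` of §3 (sites of the blocks, distance (I.1.3)); p19's `boxTreeLen` of the relative label boxes is our
chart-side quantity; §3's comparison lemma `torusTreeLen_le_boxTreeLen_relBox` (every base block; `tdist ≤ supDist`) is the direction
the estimate needs, and `abs_graphAmp_le_ineq213_torus` states (2.13) with the torus tree length; equality of the two tree lengths for
configurations in the half-box is not needed and not claimed.  (e) Print never displays the chart; the box reading is p19's, the
based chart FILE 17's, the assembly ours — fixed so that the output is LITERALLY p19's proved (2.13).  Unit `lit-balaban-p26` gen 46
(literature-prover-lit-balaban-p26-g46-0), HOME `run/shared/lean/pub/lit-balaban/`, 2026-08-25.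
-/

open Finset
open scoped BigOperators

namespace Literature.MathematicalPhysics.QuantumFieldTheory.Balaban1983to89.B3Ineq213TorusBlocks

open Literature.MathematicalPhysics.QuantumFieldTheory.Balaban1983to89.B3Cor23Concrete (Graph)
open Literature.MathematicalPhysics.QuantumFieldTheory.Balaban1983to89.B3GraphAmplitude
open Literature.MathematicalPhysics.QuantumFieldTheory.Balaban1983to89.B3GraphAmplitudeRules
open Literature.MathematicalPhysics.QuantumFieldTheory.Balaban1983to89.B3GraphAmplitudePositionForm
open Literature.MathematicalPhysics.QuantumFieldTheory.Balaban1983to89.B3Eq213TorusBoxSeam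
open Literature.MathematicalPhysics.QuantumFieldTheory.Balaban1983to89.B3Ineq213
open Literature.MathematicalPhysics.QuantumFieldTheory.Balaban1983to89.B3Ineq215 (Cube)
open Literature.MathematicalPhysics.QuantumFieldTheory.Balaban1983to89.HiggsAveraging (blockIter blockK mem_blockK)

noncomputable section

/-! ## §1 The base block, the relative block positions and the based charts of a block configuration -/

section Base

variable {P : HiggsLattice.Params} {k : ℕ}

/-- **The base block `p − D`** about which a configuration of blocks within torus distance `D` of the block `p ∈ T^{(k)}` is
charted (FILE 17 §8's choice `c₀ := p − D`). [cite: Balaban1982Higgs1, (1.3) p.604] [cite: Balaban1983Higgs3, (2.13) p.426] -/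
def baseBlock (p : HiggsLattice.Site P k) (D : ℕ) : HiggsLattice.Site P k :=
  fun μ => p μ - ((D : ℕ) : ZMod (P.sitesPerDir k μ))

/-- Unfolding of `baseBlock`. [cite: Balaban1982Higgs1, (1.3) p.604] -/
theorem baseBlock_apply (p : HiggsLattice.Site P k) (D : ℕ) (μ : Fin P.d) :
    baseBlock p D μ = p μ - ((D : ℕ) : ZMod (P.sitesPerDir k μ)) := rfl

/-- **The RELATIVE block position** of the block `y ∈ T^{(k)}` with respect to the base block `c₀`: the label vector of `y − c₀`
(FILE 17's `labelsOf`) — p19's box position `box v` of the unit cube `□(v) = B^k(y_v)` in the chart about `c₀`.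
[cite: Balaban1983Higgs3, p.420] [cite: Balaban1983Higgs3, (2.13) p.426] -/
def relBox (c₀ y : HiggsLattice.Site P k) : Fin P.d → ℕ :=
  labelsOf (P := P) (i := k) fun μ => y μ - c₀ μ

/-- Unfolding of `relBox`. [cite: Balaban1983Higgs3, (2.13) p.426] -/
theorem relBox_apply (c₀ y : HiggsLattice.Site P k) (μ : Fin P.d) : relBox c₀ y μ = (y μ - c₀ μ).val := rfl

/-- Relative block positions are honest labels of `T^{(k)}`: `< 2L^{K−k}ML′_μ`. [cite: Balaban1982Higgs1, (1.2) p.604] -/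
theorem relBox_lt_sitesPerDir (c₀ y : HiggsLattice.Site P k) (μ : Fin P.d) : relBox c₀ y μ < P.sitesPerDir k μ :=
  labelsOf_lt _ μ

/-- **The relative positions about `p − D` of blocks within torus distance `D` of `p` lie in the HALF-BOX** (`2D < L^{K−k}ML′_μ`):
FILE 17's `relLabels_lt_half_of_tdist_le`. [cite: Balaban1982Higgs1, (1.3) p.604] [cite: Balaban1983Higgs3, (2.13) p.426] -/
theorem relBox_baseBlock_lt_half {y p : HiggsLattice.Site P k} {D : ℕ} (h : HiggsLattice.Site.tdist y p ≤ D)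
    (hD : ∀ μ, 2 * D < P.halfPerDir k μ) (μ : Fin P.d) : relBox (baseBlock p D) y μ < P.halfPerDir k μ :=
  relLabels_lt_half_of_tdist_le h hD μ

/-- **FILE 12 §7's `hinj` for the based chart**: `labelChartAt P 0 (blockCorner c₀)` is injective on the points of p19's cube at any
relative block position. [cite: Balaban1983Higgs3, (2.13) p.426] -/
theorem injOn_pts_relBox (hk : k ≤ P.K) (c₀ y : HiggsLattice.Site P k) :
    Set.InjOn (labelChartAt P 0 (blockCorner c₀)) ↑(pts P.L (⟨k, relBox c₀ y⟩ : Cube P.d)) :=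
  labelChartAt_injOn_pts hk (blockCorner c₀) (relBox_lt_sitesPerDir c₀ y)

/-- Every site of the block `B^k(y)` is the based chart of a point of the cube at the relative position of `y` (FILE 17's
`mem_blockK_iff_exists_labelChartAt`). [cite: Balaban1983Higgs3, p.420] [cite: Balaban1982Higgs1, (1.20) p.607] -/
theorem exists_pts_relBox_of_mem_blockK (hk : k ≤ P.K) (c₀ y : HiggsLattice.Site P k) {x : HiggsLattice.Site P 0}
    (hx : x ∈ blockK k y) : ∃ ξ ∈ pts P.L (⟨k, relBox c₀ y⟩ : Cube P.d), labelChartAt P 0 (blockCorner c₀) ξ = x :=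
  (mem_blockK_iff_exists_labelChartAt hk c₀ y x).1 hx

/-- Conversely the based chart of a point of the cube at the relative position of `y` is a site of `B^k(y)`.
[cite: Balaban1983Higgs3, p.420] [cite: Balaban1982Higgs1, (1.20) p.607] -/
theorem mem_blockK_of_mem_pts_relBox (hk : k ≤ P.K) (c₀ y : HiggsLattice.Site P k) {ξ : Fin P.d → ℕ}
    (hξ : ξ ∈ pts P.L (⟨k, relBox c₀ y⟩ : Cube P.d)) : labelChartAt P 0 (blockCorner c₀) ξ ∈ blockK k y :=
  (mem_blockK_iff_exists_labelChartAt hk c₀ y _).2 ⟨ξ, hξ, rfl⟩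

/-- **FILE 12 §7's `hsupp` from BLOCK SUPPORT**: vertex functions supported in the blocks `B^k(y_v)` are supported on the images of
the cubes at the relative positions under the based chart. [cite: Balaban1983Higgs3, p.420] [cite: Balaban1983Higgs3, (2.13) p.426] -/
theorem supp_of_blockSupport (hk : k ≤ P.K) (c₀ : HiggsLattice.Site P k) {V : Type*} (y : V → HiggsLattice.Site P k)
    (U : V → HiggsLattice.Site P 0 → ℝ) (hloc : ∀ v x, x ∉ blockK k (y v) → U v x = 0) :
    ∀ v x, U v x ≠ 0 → ∃ ξ ∈ pts P.L (⟨k, relBox c₀ (y v)⟩ : Cube P.d), labelChartAt P 0 (blockCorner c₀) ξ = x := by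
  intro v x hx
  refine exists_pts_relBox_of_mem_blockK hk c₀ (y v) ?_
  by_contra h
  exact hx (hloc v x h)

/-- For two blocks whose relative positions lie in the half-box, the torus distance (I.1.3) of based-charted points of their cubes IS
p19's box distance of the labels (FILE 17's `tdist_labelChartAt_eq_supDist_of_blocks`). [cite: Balaban1982Higgs1, (1.3) p.604]
[cite: Balaban1983Higgs3, (2.13) p.426] -/
theorem tdist_basedChart_eq_supDist (hk : k ≤ P.K) (c₀ : HiggsLattice.Site P k) {y y' : HiggsLattice.Site P k}
    (hz : ∀ μ, relBox c₀ y μ < P.halfPerDir k μ) (hz' : ∀ μ, relBox c₀ y' μ < P.halfPerDir k μ) {ξ ξ' : Fin P.d → ℕ}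
    (hξ : ξ ∈ pts P.L (⟨k, relBox c₀ y⟩ : Cube P.d)) (hξ' : ξ' ∈ pts P.L (⟨k, relBox c₀ y'⟩ : Cube P.d)) :
    HiggsLattice.Site.tdist (labelChartAt P 0 (blockCorner c₀) ξ) (labelChartAt P 0 (blockCorner c₀) ξ') = supDist ξ ξ' :=
  tdist_labelChartAt_eq_supDist_of_blocks hk (blockCorner c₀) hz hz' hξ hξ'

/-- **p19's `K_le` FROM TORUS-SHAPE LINE BOUNDS**: if the kernels `K_l(t; x, x′)` of the lines obey, for ALL sites of `T_η`,
`|K_l(t; x, x′)| ≤ C_l s_t^{a_l} exp[−(2δ₀∕s_t)(η·tdist(x, x′))]` (the torus form of (2.10)–(2.12), `s_t = L^tη`), then the kernels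
READ THROUGH THE BASED CHART about `c₀` obey the body of p19's `Amp.K_le` ∕ FILE 12 §7's `K_le` (the same bound with the box distance
`supDist` of the labels) on the points of the cubes at the relative positions of the endpoint blocks — provided all relative positions
lie in the half-box (no wrap-around). [cite: Balaban1983Higgs3, (2.10) p.426] [cite: Balaban1983Higgs3, (2.13) p.426] -/
theorem lineBounds_basedChart_of_torus (hk : k ≤ P.K) (c₀ : HiggsLattice.Site P k) {V : Type*} {y : V → HiggsLattice.Site P k}
    (hz : ∀ v μ, relBox c₀ (y v) μ < P.halfPerDir k μ) {m : ℕ} (src tgt : Fin m → V)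
    (K : Fin m → ℕ → HiggsLattice.Site P 0 → HiggsLattice.Site P 0 → ℝ) (C : Fin m → ℝ) (sc : ℕ → ℝ) (a : Fin m → ℝ)
    (δ₀ η : ℝ)
    (hKT : ∀ l t, t < k → ∀ x x', |K l t x x'| ≤
      C l * sc t ^ a l * Real.exp (-(2 * δ₀ / sc t * (η * (HiggsLattice.Site.tdist x x' : ℝ))))) :
    ∀ l t, t < k → ∀ ξ ∈ pts P.L (⟨k, relBox c₀ (y (src l))⟩ : Cube P.d), ∀ ξ' ∈ pts P.L (⟨k, relBox c₀ (y (tgt l))⟩ : Cube P.d),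
      |K l t (labelChartAt P 0 (blockCorner c₀) ξ) (labelChartAt P 0 (blockCorner c₀) ξ')| ≤
        C l * sc t ^ a l * Real.exp (-(2 * δ₀ / sc t * (η * (supDist ξ ξ' : ℝ)))) := by
  intro l t ht ξ hξ ξ' hξ'
  have h := hKT l t ht (labelChartAt P 0 (blockCorner c₀) ξ) (labelChartAt P 0 (blockCorner c₀) ξ')
  rwa [tdist_basedChart_eq_supDist hk c₀ (hz (src l)) (hz (tgt l)) hξ hξ'] at h

end Base

/-! ## §2 (2.13) for the expression of a block-localized graph anywhere on `T_η` -/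

section Graphs

variable {P : HiggsLattice.Params} {N k nbar : ℕ} [DecidableEq (HiggsLattice.PBond P 0)]

/-- **`|E(G, {B^k(y_v)}, Φ_ext, A_ext)| ≤ E_j` FOR A BLOCK-LOCALIZED GRAPH ANYWHERE ON THE TORUS.**  For every graph `G` of p18's model
with its output pairing, model data, counterterms, localizations, kernels and external data (FILE 2's `graphAmp`), every enumeration
`eL` of its lines and scale assignment `j`, kernel families `K_l(t; x, x′)` dominating the line kernels contracted against the endpoint
attachments (FILE 12's `hKs/hKv/hKo`) and per-leg external data (`hΦ/hA/hΨ`): IF the vertex functions live in blocks `B^k(y_v)`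
(`hloc`) all of which lie within torus distance `D` of one block `p` with `2D < L^{K−k}ML′_μ` (`hy`, `hD`), the vertex bounds hold at
all sites (`u_le`) and the line bounds hold IN TORUS SHAPE at all sites (`hKT`: `|K_l(t;x,x′)| ≤ C_l (L^tη)^{a_l}
exp[−2δ₀(L^tη)^{−1}(η·tdist(x,x′))]`), THEN `|E| ≤ E_j` of the amplitude of p19's class packaged with the relative boxes about `p − D`
and the based charts `labelChartAt P 0 (blockCorner (p − D))` — FILE 12 §7's `abs_graphAmp_le_ampE` with `hinj`, `hsupp` discharged
(§1) and `K_le` derived from `hKT` (§1). [cite: Balaban1983Higgs3, (2.13) p.426] [cite: Balaban1983Higgs3, p.420]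
[cite: Balaban1982Higgs1, (1.3) p.604] -/
theorem abs_graphAmp_le_ampE_torusBlocks (hK : k ≤ P.K) (hL2 : 2 ≤ P.L) (G : Graph nbar) (Mh : Model P N k)
    (dm2 : Fin G.nV → HiggsLattice.Site P 0 → ℝ) (loc : Fin G.nV → Loc P k) (Po : OutPairing G)
    (Ks : SLine G → HiggsLattice.Site P 0 × Fin N → HiggsLattice.Site P 0 × Fin N → ℝ)
    (Kv : VLine G → HiggsLattice.PBond P 0 → HiggsLattice.PBond P 0 → ℝ)
    (Ko : Po.Line oRank → HiggsLattice.Site P k × Fin N → HiggsLattice.Site P k × Fin N → ℝ)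
    (Φ : (ExtSLeg G → HiggsLattice.Site P 0 × Fin N) → ℝ) (A : (ExtVLeg G → HiggsLattice.PBond P 0) → ℝ)
    (Ψ : (Po.Ext → HiggsLattice.Site P k × Fin N) → ℝ)
    {m : ℕ} (eL : Fin m ≃ Lines G Po) (e : Fin G.nV → ℝ) (a : Fin m → ℝ) (δ₀ : ℝ) (hδ : 0 < δ₀) (j : Fin m → ℕ)
    (K : Fin m → ℕ → HiggsLattice.Site P 0 → HiggsLattice.Site P 0 → ℝ)
    (hKs : ∀ (l : SLine G) (x x' : HiggsLattice.Site P 0),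
      ∑ p, ∑ p', attSK (G.kind l.1.1) l.1.2 x p * attSK (G.kind ((sPairing G).mate l.1).1) ((sPairing G).mate l.1).2 x' p' *
        |Ks l p p'| ≤ K (eL.symm (Sum.inl l)) (j (eL.symm (Sum.inl l))) x x')
    (hKv : ∀ (l : VLine G) (x x' : HiggsLattice.Site P 0),
      ∑ b, ∑ b', attVK Mh.ctr (G.kind l.1.1) x b * attVK Mh.ctr (G.kind ((vPairing G).mate l.1).1) x' b' * |Kv l b b'| ≤
        K (eL.symm (Sum.inr (Sum.inl l))) (j (eL.symm (Sum.inr (Sum.inl l)))) x x')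
    (hKo : ∀ (l : Po.Line oRank) (x x' : HiggsLattice.Site P 0),
      ∑ r, ∑ r', attO k x r * attO k x' r' * |Ko l r r'| ≤ K (eL.symm (Sum.inr (Sum.inr l))) (j (eL.symm (Sum.inr (Sum.inr l)))) x x')
    (nS : ExtSLeg G → HiggsLattice.Site P 0 → ℝ)
    (hΦ : ∀ ξ : ExtSLeg G → HiggsLattice.Site P 0,
      ∑ γ : ExtSLeg G → HiggsLattice.Site P 0 × Fin N, (∏ e, attSK (G.kind e.1.1) e.1.2 (ξ e) (γ e)) * |Φ γ| ≤ ∏ e, nS e (ξ e))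
    (nV : ExtVLeg G → HiggsLattice.Site P 0 → ℝ)
    (hA : ∀ ξ : ExtVLeg G → HiggsLattice.Site P 0,
      ∑ ζ : ExtVLeg G → HiggsLattice.PBond P 0, (∏ e, attVK Mh.ctr (G.kind e.1.1) (ξ e) (ζ e)) * |A ζ| ≤ ∏ e, nV e (ξ e))
    (nO : Po.Ext → HiggsLattice.Site P 0 → ℝ)
    (hΨ : ∀ ξ : Po.Ext → HiggsLattice.Site P 0,
      ∑ ο : Po.Ext → HiggsLattice.Site P k × Fin N, (∏ e, attO k (ξ e) (ο e)) * |Ψ ο| ≤ ∏ e, nO e (ξ e))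
    (y : Fin G.nV → HiggsLattice.Site P k)
    (hloc : ∀ v x, x ∉ blockK k (y v) → uOfKind Mh (dm2 v) (loc v) (G.kind v) x = 0)
    (p : HiggsLattice.Site P k) (D : ℕ) (hy : ∀ v, HiggsLattice.Site.tdist (y v) p ≤ D) (hD : ∀ μ, 2 * D < P.halfPerDir k μ)
    (C : Fin m → ℝ) (eRun lamRun : ℝ) (dv ds : Fin G.nV → ℕ) (NPhi NA : Fin G.nV → ℝ)
    (C_nonneg : ∀ l, 0 ≤ C l) (eRun_nonneg : 0 ≤ eRun) (lamRun_nonneg : 0 ≤ lamRun) (NPhi_nonneg : ∀ v, 0 ≤ NPhi v)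
    (NA_nonneg : ∀ v, 0 ≤ NA v) (e_nonneg : ∀ v, 0 ≤ e v)
    (conn : LinesConnect (fun i => lineSrc Po (eL i)) (fun i => lineTgt Po (eL i)))
    (u_le : ∀ v x, |((P.L : ℝ) ^ k) ^ P.d * (uOfKind Mh (dm2 v) (loc v) (G.kind v) x * extAt Po nS nV nO v x)| ≤
      eRun ^ dv v * lamRun ^ ds v * NPhi v * NA v * (((P.L : ℝ) ^ k)⁻¹) ^ e v)
    (hKT : ∀ l t, t < k → ∀ x x', |K l t x x'| ≤
      C l * (modelOfGraph G Po eL e a P.d P.L δ₀ P.hd hL2 hδ).sc k t ^ a l *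
        Real.exp (-(2 * δ₀ / (modelOfGraph G Po eL e a P.d P.L δ₀ P.hd hL2 hδ).sc k t *
          (((P.L : ℝ) ^ k)⁻¹ * (HiggsLattice.Site.tdist x x' : ℝ))))) :
    |graphAmp G Mh dm2 loc Po Ks Kv Ko Φ A Ψ| ≤
      (ampOf (modelOfGraph G Po eL e a P.d P.L δ₀ P.hd hL2 hδ) k (fun v => relBox (baseBlock p D) (y v))
        (fun _ => labelChartAt P 0 (blockCorner (baseBlock p D)))
        (fun v x => uOfKind Mh (dm2 v) (loc v) (G.kind v) x * extAt Po nS nV nO v x) K C eRun lamRun dv ds NPhi NA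
        C_nonneg eRun_nonneg lamRun_nonneg NPhi_nonneg NA_nonneg e_nonneg conn
        (fun v ξ => u_le v (labelChartAt P 0 (blockCorner (baseBlock p D)) ξ))
        (lineBounds_basedChart_of_torus hK (baseBlock p D) (y := y) (fun v μ => relBox_baseBlock_lt_half (hy v) hD μ)
          (modelOfGraph G Po eL e a P.d P.L δ₀ P.hd hL2 hδ).src (modelOfGraph G Po eL e a P.d P.L δ₀ P.hd hL2 hδ).tgt K C
          ((modelOfGraph G Po eL e a P.d P.L δ₀ P.hd hL2 hδ).sc k) a δ₀ (((P.L : ℝ) ^ k)⁻¹) hKT)).E j := by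
  refine abs_graphAmp_le_ampE G Mh dm2 loc Po Ks Kv Ko Φ A Ψ eL e a P.d P.L δ₀ P.hd hL2 hδ j K hKs hKv hKo nS hΦ nV hA nO hΨ
    k (fun v => relBox (baseBlock p D) (y v)) (fun _ => labelChartAt P 0 (blockCorner (baseBlock p D)))
    (fun v => injOn_pts_relBox hK (baseBlock p D) (y v)) (fun v x hx => ?_) C eRun lamRun dv ds NPhi NA C_nonneg eRun_nonneg
    lamRun_nonneg NPhi_nonneg NA_nonneg e_nonneg conn _ _
  -- support: off `B^k(y_v)` the vertex function vanishes
  refine exists_pts_relBox_of_mem_blockK hK (baseBlock p D) (y v) ?_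
  by_contra hxB
  exact hx (by rw [hloc v x hxB, zero_mul])

/-- **(2.13) FOR THE EXPRESSION OF A BLOCK-LOCALIZED GRAPH ANYWHERE ON `T_η`** — the previous theorem composed with p19's PROVED
(2.13) `B3Ineq213Proof.Amp.abs_E_le`: for every scale assignment `j ∈ J(l̃)` (gen-2's `Model.Mon m k`),
`|E(G(j), {B^k(y_v)}, Φ′_ext, A_ext)| ≤ (Π_l C_l) · e(L^kε)^{d_v(G)} λ(L^kε)^{d_s(G)} exp[−δ₀ d({□(v)})] (Π_v N^Φ_v)(Π_v N^A_v) ·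
Σ_{{Δ(v)}} Ẽ(G(j), {Δ(v)})`, with `d({□(v)})` p19's `boxTreeLen` of the relative boxes (§3 replaces it by print's torus tree length) and
the last factor gen-2's weight sum `Model.W 0 k j` of (2.14). [cite: Balaban1983Higgs3, (2.13) p.426] [cite: Balaban1983Higgs3, (2.14) p.427] -/
theorem abs_graphAmp_le_ineq213_torusBlocks (hK : k ≤ P.K) (hL2 : 2 ≤ P.L) (G : Graph nbar) (Mh : Model P N k)
    (dm2 : Fin G.nV → HiggsLattice.Site P 0 → ℝ) (loc : Fin G.nV → Loc P k) (Po : OutPairing G)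
    (Ks : SLine G → HiggsLattice.Site P 0 × Fin N → HiggsLattice.Site P 0 × Fin N → ℝ)
    (Kv : VLine G → HiggsLattice.PBond P 0 → HiggsLattice.PBond P 0 → ℝ)
    (Ko : Po.Line oRank → HiggsLattice.Site P k × Fin N → HiggsLattice.Site P k × Fin N → ℝ)
    (Φ : (ExtSLeg G → HiggsLattice.Site P 0 × Fin N) → ℝ) (A : (ExtVLeg G → HiggsLattice.PBond P 0) → ℝ)
    (Ψ : (Po.Ext → HiggsLattice.Site P k × Fin N) → ℝ)
    {m : ℕ} (eL : Fin m ≃ Lines G Po) (e : Fin G.nV → ℝ) (a : Fin m → ℝ) (δ₀ : ℝ) (hδ : 0 < δ₀) {j : Fin m → ℕ}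
    (hj : j ∈ B3Ineq215.Model.Mon m k)
    (K : Fin m → ℕ → HiggsLattice.Site P 0 → HiggsLattice.Site P 0 → ℝ)
    (hKs : ∀ (l : SLine G) (x x' : HiggsLattice.Site P 0),
      ∑ p, ∑ p', attSK (G.kind l.1.1) l.1.2 x p * attSK (G.kind ((sPairing G).mate l.1).1) ((sPairing G).mate l.1).2 x' p' *
        |Ks l p p'| ≤ K (eL.symm (Sum.inl l)) (j (eL.symm (Sum.inl l))) x x')
    (hKv : ∀ (l : VLine G) (x x' : HiggsLattice.Site P 0),
      ∑ b, ∑ b', attVK Mh.ctr (G.kind l.1.1) x b * attVK Mh.ctr (G.kind ((vPairing G).mate l.1).1) x' b' * |Kv l b b'| ≤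
        K (eL.symm (Sum.inr (Sum.inl l))) (j (eL.symm (Sum.inr (Sum.inl l)))) x x')
    (hKo : ∀ (l : Po.Line oRank) (x x' : HiggsLattice.Site P 0),
      ∑ r, ∑ r', attO k x r * attO k x' r' * |Ko l r r'| ≤ K (eL.symm (Sum.inr (Sum.inr l))) (j (eL.symm (Sum.inr (Sum.inr l)))) x x')
    (nS : ExtSLeg G → HiggsLattice.Site P 0 → ℝ)
    (hΦ : ∀ ξ : ExtSLeg G → HiggsLattice.Site P 0,
      ∑ γ : ExtSLeg G → HiggsLattice.Site P 0 × Fin N, (∏ e, attSK (G.kind e.1.1) e.1.2 (ξ e) (γ e)) * |Φ γ| ≤ ∏ e, nS e (ξ e))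
    (nV : ExtVLeg G → HiggsLattice.Site P 0 → ℝ)
    (hA : ∀ ξ : ExtVLeg G → HiggsLattice.Site P 0,
      ∑ ζ : ExtVLeg G → HiggsLattice.PBond P 0, (∏ e, attVK Mh.ctr (G.kind e.1.1) (ξ e) (ζ e)) * |A ζ| ≤ ∏ e, nV e (ξ e))
    (nO : Po.Ext → HiggsLattice.Site P 0 → ℝ)
    (hΨ : ∀ ξ : Po.Ext → HiggsLattice.Site P 0,
      ∑ ο : Po.Ext → HiggsLattice.Site P k × Fin N, (∏ e, attO k (ξ e) (ο e)) * |Ψ ο| ≤ ∏ e, nO e (ξ e))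
    (y : Fin G.nV → HiggsLattice.Site P k)
    (hloc : ∀ v x, x ∉ blockK k (y v) → uOfKind Mh (dm2 v) (loc v) (G.kind v) x = 0)
    (p : HiggsLattice.Site P k) (D : ℕ) (hy : ∀ v, HiggsLattice.Site.tdist (y v) p ≤ D) (hD : ∀ μ, 2 * D < P.halfPerDir k μ)
    (C : Fin m → ℝ) (eRun lamRun : ℝ) (dv ds : Fin G.nV → ℕ) (NPhi NA : Fin G.nV → ℝ)
    (C_nonneg : ∀ l, 0 ≤ C l) (eRun_nonneg : 0 ≤ eRun) (lamRun_nonneg : 0 ≤ lamRun) (NPhi_nonneg : ∀ v, 0 ≤ NPhi v)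
    (NA_nonneg : ∀ v, 0 ≤ NA v) (e_nonneg : ∀ v, 0 ≤ e v)
    (conn : LinesConnect (fun i => lineSrc Po (eL i)) (fun i => lineTgt Po (eL i)))
    (u_le : ∀ v x, |((P.L : ℝ) ^ k) ^ P.d * (uOfKind Mh (dm2 v) (loc v) (G.kind v) x * extAt Po nS nV nO v x)| ≤
      eRun ^ dv v * lamRun ^ ds v * NPhi v * NA v * (((P.L : ℝ) ^ k)⁻¹) ^ e v)
    (hKT : ∀ l t, t < k → ∀ x x', |K l t x x'| ≤
      C l * (modelOfGraph G Po eL e a P.d P.L δ₀ P.hd hL2 hδ).sc k t ^ a l *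
        Real.exp (-(2 * δ₀ / (modelOfGraph G Po eL e a P.d P.L δ₀ P.hd hL2 hδ).sc k t *
          (((P.L : ℝ) ^ k)⁻¹ * (HiggsLattice.Site.tdist x x' : ℝ))))) :
    |graphAmp G Mh dm2 loc Po Ks Kv Ko Φ A Ψ| ≤
      (∏ l, C l) *
        (eRun ^ (∑ v, dv v) * lamRun ^ (∑ v, ds v) *
            Real.exp (-(δ₀ * boxTreeLen P.L k (fun v => relBox (baseBlock p D) (y v)))) * (∏ v, NPhi v) * ∏ v, NA v) *
        (modelOfGraph G Po eL e a P.d P.L δ₀ P.hd hL2 hδ).W 0 k j (fun v => relBox (baseBlock p D) (y v)) := by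
  have h1 := abs_graphAmp_le_ampE_torusBlocks hK hL2 G Mh dm2 loc Po Ks Kv Ko Φ A Ψ eL e a δ₀ hδ j K hKs hKv hKo nS hΦ nV hA
    nO hΨ y hloc p D hy hD C eRun lamRun dv ds NPhi NA C_nonneg eRun_nonneg lamRun_nonneg NPhi_nonneg NA_nonneg e_nonneg conn
    u_le hKT
  refine h1.trans ((le_abs_self _).trans ?_)
  exact Amp.abs_E_le _ hj

end Graphs

/-! ## §3 Print's tree length `d({□(v)}_{v∈G})` on the torus, and (2.13) with it -/

section TorusTreeLength

variable {P : HiggsLattice.Params} {k : ℕ} {V : Type*}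

/-- The tree length is monotone in the edge lengths. [cite: Balaban1983Higgs3, (1.33) p.420] -/
theorem treeLen_mono [Fintype V] [DecidableEq V] {ρ ρ' : V → V → ℝ} (h : ∀ u w, ρ u w ≤ ρ' u w) :
    treeLen ρ ≤ treeLen ρ' := by
  unfold treeLen
  refine Finset.le_inf' _ _ fun S hS => ?_
  exact (Finset.inf'_le _ hS).trans (Finset.sum_le_sum fun e _ => h e.1 e.2)

/-- The TORUS edge lengths of a tuple of sites of `T_η`: `η·|x_u − x_w|` with the printed torus distance (I.1.3), `η = L^{−k}`
(lattice units of `T_η`, as p19's `edgeLen` = `η·supDist` for labels). [cite: Balaban1982Higgs1, (1.3) p.604]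
[cite: Balaban1983Higgs3, (1.33) p.420] -/
def torusEdgeLen (k : ℕ) (x : V → HiggsLattice.Site P 0) (u w : V) : ℝ :=
  ((P.L : ℝ) ^ k)⁻¹ * (HiggsLattice.Site.tdist (x u) (x w) : ℝ)

/-- Torus edge lengths are non-negative. [cite: Balaban1983Higgs3, (1.33) p.420] -/
theorem torusEdgeLen_nonneg (k : ℕ) (x : V → HiggsLattice.Site P 0) (u w : V) : 0 ≤ torusEdgeLen k x u w := by
  unfold torusEdgeLen
  positivity

variable [Fintype V] [DecidableEq V]

/-- The admissible site tuples of a block configuration: `x_v ∈ B^k(y_v)` for every vertex (p. 420: the vertices are localized in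
the unit cubes `B^k(y)`). [cite: Balaban1983Higgs3, p.420] -/
def blockPositions (k : ℕ) (y : V → HiggsLattice.Site P k) : Finset (V → HiggsLattice.Site P 0) :=
  Fintype.piFinset fun v => blockK k (y v)

/-- Membership in `blockPositions`. [cite: Balaban1983Higgs3, p.420] -/
theorem mem_blockPositions {y : V → HiggsLattice.Site P k} {x : V → HiggsLattice.Site P 0} :
    x ∈ blockPositions k y ↔ ∀ v, x v ∈ blockK k (y v) :=
  Fintype.mem_piFinset

/-- There are admissible site tuples (`k ≤ K`: every block has a site, e.g. the based chart of a point of its cube).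
[cite: Balaban1983Higgs3, p.420] -/
theorem blockPositions_nonempty (hk : k ≤ P.K) (y : V → HiggsLattice.Site P k) : (blockPositions k y).Nonempty := by
  refine Fintype.piFinset_nonempty.2 fun v => ?_
  obtain ⟨ξ, hξ⟩ := pts_nonempty P.hL (⟨k, relBox (y v) (y v)⟩ : Cube P.d)
  exact ⟨_, mem_blockK_of_mem_pts_relBox hk (y v) (y v) hξ⟩

/-- **`d({□(v)}_{v∈G})` ON THE TORUS** for the block configuration `{B^k(y_v)}`: *"a length of a shortest tree graph connecting the
vertices v localized in □(v), v ∈ G"* — the minimum over the sites `x_v ∈ B^k(y_v)` of the tree length of `{x_v}` in the printed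
torus distance `η·tdist` (p19's `boxTreeLen` is the same with labels and `η·supDist`). [cite: Balaban1983Higgs3, (1.33) p.420]
[cite: Balaban1982Higgs1, (1.3) p.604] -/
def torusTreeLen (k : ℕ) (y : V → HiggsLattice.Site P k) : ℝ :=
  sInf ((fun x => treeLen (torusEdgeLen k x)) '' (blockPositions k y : Set (V → HiggsLattice.Site P 0)))

/-- The torus tree length is at most the tree length of every admissible site tuple. [cite: Balaban1983Higgs3, (1.33) p.420] -/
theorem torusTreeLen_le_treeLen {y : V → HiggsLattice.Site P k} {x : V → HiggsLattice.Site P 0} (hx : x ∈ blockPositions k y) :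
    torusTreeLen k y ≤ treeLen (torusEdgeLen k x) :=
  csInf_le (((blockPositions k y).finite_toSet.image _).bddBelow) ⟨x, Finset.mem_coe.2 hx, rfl⟩

/-- `d_T({B^k(y_v)}) ≥ 0`. [cite: Balaban1983Higgs3, (1.33) p.420] -/
theorem torusTreeLen_nonneg (k : ℕ) (y : V → HiggsLattice.Site P k) : 0 ≤ torusTreeLen k y := by
  refine Real.sInf_nonneg ?_
  rintro _ ⟨x, _, rfl⟩
  exact treeLen_nonneg fun u w => torusEdgeLen_nonneg k x u w

/-- **THE TORUS TREE LENGTH IS AT MOST p19's BOX TREE LENGTH OF THE RELATIVE BOXES — for EVERY base block `c₀`**: every label position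
tuple of the relative boxes charts (based chart about `c₀`) to a site tuple of the blocks, with torus edge lengths at most the box
edge lengths (`tdist ≤ supDist` always, FILE 17's `tdist_labelChartAt_le_supDist`); no half-box hypothesis is needed for this direction.
[cite: Balaban1983Higgs3, (1.33) p.420] [cite: Balaban1982Higgs1, (1.3) p.604] [cite: Balaban1983Higgs3, (2.13) p.426] -/
theorem torusTreeLen_le_boxTreeLen_relBox (hk : k ≤ P.K) (c₀ : HiggsLattice.Site P k) (y : V → HiggsLattice.Site P k) :
    torusTreeLen k y ≤ boxTreeLen P.L k (fun v => relBox c₀ (y v)) := by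
  unfold boxTreeLen
  obtain ⟨ξ₀, hξ₀⟩ := boxPositions_nonempty P.hL k (fun v => relBox c₀ (y v))
  refine le_csInf ⟨_, ⟨ξ₀, Finset.mem_coe.2 hξ₀, rfl⟩⟩ ?_
  rintro _ ⟨ξ, hξ, rfl⟩
  have hx : (fun v => labelChartAt P 0 (blockCorner c₀) (ξ v)) ∈ blockPositions k y :=
    mem_blockPositions.2 fun v => mem_blockK_of_mem_pts_relBox hk c₀ (y v) ((mem_boxPositions.1 (Finset.mem_coe.1 hξ)) v)
  refine (torusTreeLen_le_treeLen hx).trans (treeLen_mono fun u w => ?_)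
  unfold torusEdgeLen edgeLen
  exact mul_le_mul_of_nonneg_left (Nat.cast_le.2 (tdist_labelChartAt_le_supDist _ _ _))
    (inv_nonneg.2 (pow_nonneg (Nat.cast_nonneg _) _))

/-- Hence the exponential factor of (2.13) with p19's box tree length of the relative boxes is dominated by the one with print's torus
tree length: `exp[−δ₀·boxTreeLen] ≤ exp[−δ₀·d_T({B^k(y_v)})]` (`δ₀ ≥ 0`). [cite: Balaban1983Higgs3, (2.13) p.426] -/
theorem exp_boxTreeLen_relBox_le (hk : k ≤ P.K) (c₀ : HiggsLattice.Site P k) (y : V → HiggsLattice.Site P k) {δ₀ : ℝ}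
    (hδ : 0 ≤ δ₀) :
    Real.exp (-(δ₀ * boxTreeLen P.L k (fun v => relBox c₀ (y v)))) ≤ Real.exp (-(δ₀ * torusTreeLen k y)) :=
  Real.exp_le_exp.2 (neg_le_neg (mul_le_mul_of_nonneg_left (torusTreeLen_le_boxTreeLen_relBox hk c₀ y) hδ))

end TorusTreeLength

section GraphsTorus

variable {P : HiggsLattice.Params} {N k nbar : ℕ} [DecidableEq (HiggsLattice.PBond P 0)]

/-- **(2.13) FOR A BLOCK-LOCALIZED GRAPH ANYWHERE ON `T_η`, WITH PRINT'S TORUS TREE LENGTH `d({□(v)}_{v∈G})`**: as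
`abs_graphAmp_le_ineq213_torusBlocks`, the factor `exp[−δ₀ d]` now carrying the torus tree length `torusTreeLen k y` of the block set
`{B^k(y_v)}` (§3: `torusTreeLen ≤ boxTreeLen` of the relative boxes). [cite: Balaban1983Higgs3, (2.13) p.426]
[cite: Balaban1983Higgs3, (1.33) p.420] [cite: Balaban1982Higgs1, (1.3) p.604] -/
theorem abs_graphAmp_le_ineq213_torus (hK : k ≤ P.K) (hL2 : 2 ≤ P.L) (G : Graph nbar) (Mh : Model P N k)
    (dm2 : Fin G.nV → HiggsLattice.Site P 0 → ℝ) (loc : Fin G.nV → Loc P k) (Po : OutPairing G)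
    (Ks : SLine G → HiggsLattice.Site P 0 × Fin N → HiggsLattice.Site P 0 × Fin N → ℝ)
    (Kv : VLine G → HiggsLattice.PBond P 0 → HiggsLattice.PBond P 0 → ℝ)
    (Ko : Po.Line oRank → HiggsLattice.Site P k × Fin N → HiggsLattice.Site P k × Fin N → ℝ)
    (Φ : (ExtSLeg G → HiggsLattice.Site P 0 × Fin N) → ℝ) (A : (ExtVLeg G → HiggsLattice.PBond P 0) → ℝ)
    (Ψ : (Po.Ext → HiggsLattice.Site P k × Fin N) → ℝ)
    {m : ℕ} (eL : Fin m ≃ Lines G Po) (e : Fin G.nV → ℝ) (a : Fin m → ℝ) (δ₀ : ℝ) (hδ : 0 < δ₀) {j : Fin m → ℕ}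
    (hj : j ∈ B3Ineq215.Model.Mon m k)
    (K : Fin m → ℕ → HiggsLattice.Site P 0 → HiggsLattice.Site P 0 → ℝ)
    (hKs : ∀ (l : SLine G) (x x' : HiggsLattice.Site P 0),
      ∑ p, ∑ p', attSK (G.kind l.1.1) l.1.2 x p * attSK (G.kind ((sPairing G).mate l.1).1) ((sPairing G).mate l.1).2 x' p' *
        |Ks l p p'| ≤ K (eL.symm (Sum.inl l)) (j (eL.symm (Sum.inl l))) x x')
    (hKv : ∀ (l : VLine G) (x x' : HiggsLattice.Site P 0),
      ∑ b, ∑ b', attVK Mh.ctr (G.kind l.1.1) x b * attVK Mh.ctr (G.kind ((vPairing G).mate l.1).1) x' b' * |Kv l b b'| ≤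
        K (eL.symm (Sum.inr (Sum.inl l))) (j (eL.symm (Sum.inr (Sum.inl l)))) x x')
    (hKo : ∀ (l : Po.Line oRank) (x x' : HiggsLattice.Site P 0),
      ∑ r, ∑ r', attO k x r * attO k x' r' * |Ko l r r'| ≤ K (eL.symm (Sum.inr (Sum.inr l))) (j (eL.symm (Sum.inr (Sum.inr l)))) x x')
    (nS : ExtSLeg G → HiggsLattice.Site P 0 → ℝ)
    (hΦ : ∀ ξ : ExtSLeg G → HiggsLattice.Site P 0,
      ∑ γ : ExtSLeg G → HiggsLattice.Site P 0 × Fin N, (∏ e, attSK (G.kind e.1.1) e.1.2 (ξ e) (γ e)) * |Φ γ| ≤ ∏ e, nS e (ξ e))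
    (nV : ExtVLeg G → HiggsLattice.Site P 0 → ℝ)
    (hA : ∀ ξ : ExtVLeg G → HiggsLattice.Site P 0,
      ∑ ζ : ExtVLeg G → HiggsLattice.PBond P 0, (∏ e, attVK Mh.ctr (G.kind e.1.1) (ξ e) (ζ e)) * |A ζ| ≤ ∏ e, nV e (ξ e))
    (nO : Po.Ext → HiggsLattice.Site P 0 → ℝ)
    (hΨ : ∀ ξ : Po.Ext → HiggsLattice.Site P 0,
      ∑ ο : Po.Ext → HiggsLattice.Site P k × Fin N, (∏ e, attO k (ξ e) (ο e)) * |Ψ ο| ≤ ∏ e, nO e (ξ e))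
    (y : Fin G.nV → HiggsLattice.Site P k)
    (hloc : ∀ v x, x ∉ blockK k (y v) → uOfKind Mh (dm2 v) (loc v) (G.kind v) x = 0)
    (p : HiggsLattice.Site P k) (D : ℕ) (hy : ∀ v, HiggsLattice.Site.tdist (y v) p ≤ D) (hD : ∀ μ, 2 * D < P.halfPerDir k μ)
    (C : Fin m → ℝ) (eRun lamRun : ℝ) (dv ds : Fin G.nV → ℕ) (NPhi NA : Fin G.nV → ℝ)
    (C_nonneg : ∀ l, 0 ≤ C l) (eRun_nonneg : 0 ≤ eRun) (lamRun_nonneg : 0 ≤ lamRun) (NPhi_nonneg : ∀ v, 0 ≤ NPhi v)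
    (NA_nonneg : ∀ v, 0 ≤ NA v) (e_nonneg : ∀ v, 0 ≤ e v)
    (conn : LinesConnect (fun i => lineSrc Po (eL i)) (fun i => lineTgt Po (eL i)))
    (u_le : ∀ v x, |((P.L : ℝ) ^ k) ^ P.d * (uOfKind Mh (dm2 v) (loc v) (G.kind v) x * extAt Po nS nV nO v x)| ≤
      eRun ^ dv v * lamRun ^ ds v * NPhi v * NA v * (((P.L : ℝ) ^ k)⁻¹) ^ e v)
    (hKT : ∀ l t, t < k → ∀ x x', |K l t x x'| ≤
      C l * (modelOfGraph G Po eL e a P.d P.L δ₀ P.hd hL2 hδ).sc k t ^ a l *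
        Real.exp (-(2 * δ₀ / (modelOfGraph G Po eL e a P.d P.L δ₀ P.hd hL2 hδ).sc k t *
          (((P.L : ℝ) ^ k)⁻¹ * (HiggsLattice.Site.tdist x x' : ℝ))))) :
    |graphAmp G Mh dm2 loc Po Ks Kv Ko Φ A Ψ| ≤
      (∏ l, C l) *
        (eRun ^ (∑ v, dv v) * lamRun ^ (∑ v, ds v) * Real.exp (-(δ₀ * torusTreeLen k y)) * (∏ v, NPhi v) * ∏ v, NA v) *
        (modelOfGraph G Po eL e a P.d P.L δ₀ P.hd hL2 hδ).W 0 k j (fun v => relBox (baseBlock p D) (y v)) := by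
  have h1 := abs_graphAmp_le_ineq213_torusBlocks hK hL2 G Mh dm2 loc Po Ks Kv Ko Φ A Ψ eL e a δ₀ hδ hj K hKs hKv hKo nS hΦ nV hA
    nO hΨ y hloc p D hy hD C eRun lamRun dv ds NPhi NA C_nonneg eRun_nonneg lamRun_nonneg NPhi_nonneg NA_nonneg e_nonneg conn
    u_le hKT
  refine h1.trans ?_
  have hC : 0 ≤ ∏ l, C l := Finset.prod_nonneg fun l _ => C_nonneg l
  have hW : 0 ≤ (modelOfGraph G Po eL e a P.d P.L δ₀ P.hd hL2 hδ).W 0 k j (fun v => relBox (baseBlock p D) (y v)) :=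
    B3Ineq215.Model.W_nonneg _ 0 k j _
  have hNPhi : 0 ≤ ∏ v, NPhi v := Finset.prod_nonneg fun v _ => NPhi_nonneg v
  have hNA : 0 ≤ ∏ v, NA v := Finset.prod_nonneg fun v _ => NA_nonneg v
  have hel : 0 ≤ eRun ^ (∑ v, dv v) * lamRun ^ (∑ v, ds v) :=
    mul_nonneg (pow_nonneg eRun_nonneg _) (pow_nonneg lamRun_nonneg _)
  have hexp := exp_boxTreeLen_relBox_le hK (baseBlock p D) y hδ.le
  refine mul_le_mul_of_nonneg_right (mul_le_mul_of_nonneg_left ?_ hC) hW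
  refine mul_le_mul_of_nonneg_right (mul_le_mul_of_nonneg_right ?_ hNPhi) hNA
  exact mul_le_mul_of_nonneg_left hexp hel

end GraphsTorus

end

end Literature.MathematicalPhysics.QuantumFieldTheory.Balaban1983to89.B3Ineq213TorusBlocks
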